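import Literature.Computability.AlgebraicComplexity.CircuitGateSemantics
import Summits.ValiantsHypothesis.ValiantsHypothesis.Theorems.DepthWindowHomCop
import Mathlib.RingTheory.MvPolynomial.Homogeneous
import HarnessLib

/-!
# Band blocks of a circuit (stacking bookkeeping for `HomRelStacks`, part 2)

Route `DepthWindow`, crux item `HomSubReach`, second layer `HomRelStacks`
(`Theorems/DepthWindowHomRel.lean`).  To apply a relative block lemma `HomRel kk j` band by band,
the gates of a circuit `G` (product-depth entries `ds`) are grouped into BANDS
`bandOf kk ds i = (ds[i] - 1) / kk`.  The band-`b` BLOCK `bandBlock … G'` (for a prefix `G'` of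
`G`) is a gate list over the weighted variables `σ ⊕ (Fin n × Fin d)` — an original variable
(weight `1`) or a placeholder `y_{i,e}` (weight `e + 1`) for the degree-`(e+1)` component of the
value of a lower-band gate `i` — consisting of `n` «component-sum» gates
`s_i = coeff₀(val_i)·1 + Σ_e y_{i,e}` followed by the gates of `G'`, kept if they lie in band `b`
(with references to lower bands redirected to the `s`-gates) and blanked (`Σ []`) otherwise.
This file proves: prefix characterisations of `gateValues` / `gateWDepths` (`getD_gateValues`,
`getD_gateWDepths`, monotonicity of depth along references), the RELATIVE DEPTH bound
`≤ kk` of the band block (`gateWDepths_bandBlock_le`) and its length.  The value congruence and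
the stacking theorem are parts 3–4.

[cite: LimayeSrinivasanTavenas2025, Lemma 19, Lemma 20] [cite: Burgisser2000, Def. 2.1] [cite: LST2021, §2]
-/

set_option linter.dupNamespace false

namespace Summit.ValiantsHypothesis.ValiantsHypothesis.Theorems.DepthWindow

open MvPolynomial Literature.Computability.AlgebraicComplexity ArithCircuit
open Literature.Computability.AlgebraicComplexity.DepthReduction

variable {k : Type*} [CommSemiring k] {σ : Type*}

/-! ### Gate data of a prefix -/

/-- Entry `i` of `gateValues G` is gate `i` evaluated against the values of the first `i` gates
(`getD` form of `gateValues_getElem?`). [cite: Burgisser2000, Def. 2.1] -/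
theorem getD_gateValues (G : List (Gate k σ)) {i : ℕ} (hi : i < G.length) :
    (gateValues G).getD i 0 = G[i].eval (gateValues (G.take i)) := by
  rw [List.getD_eq_getElem?_getD, gateValues_getElem? G i _ (List.getElem?_eq_getElem hi),
    Option.getD_some]

omit [CommSemiring k] in
/-- Entry `i` of `gateWDepths wt G` is the depth of gate `i` against the first `i` entries
(`getD` form of `gateWDepths_getElem?`). [cite: LST2021, §2] -/
theorem getD_gateWDepths (wt : Gate k σ → ℕ) (G : List (Gate k σ)) {i : ℕ} (hi : i < G.length) :
    (gateWDepths wt G).getD i 0 = Gate.depthAgainst wt ((gateWDepths wt G).take i) G[i] := by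
  rw [List.getD_eq_getElem?_getD, gateWDepths_getElem? wt G i _ (List.getElem?_eq_getElem hi),
    Option.getD_some, gateWDepths_take_eq_take]
  rfl

omit [CommSemiring k] in
/-- **Depth is monotone along references**: if gate `i` refers to gate `i' < i`, then
`prodWeight G[i] + ds[i'] ≤ ds[i]`. [cite: LST2021, §2] -/
theorem getD_gateWDepths_le_of_mem_args (G : List (Gate k σ)) {i : ℕ} (hi : i < G.length) {i' : ℕ}
    (hi' : i' < i) (hmem : Operand.gate i' ∈ G[i].args) :
    prodWeight G[i] + (gateWDepths prodWeight G).getD i' 0 ≤ (gateWDepths prodWeight G).getD i 0 := by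
  rw [getD_gateWDepths prodWeight G hi, Gate.depthAgainst]
  refine Nat.add_le_add_left ?_ _
  have : (gateWDepths prodWeight G).getD i' 0 =
      Operand.depthIn ((gateWDepths prodWeight G).take i) (Operand.gate i' : Operand k σ) := by
    simp only [Operand.depthIn, List.getD_eq_getElem?_getD, List.getElem?_take_of_lt hi']
  rw [this]
  exact le_foldr_max_of_mem (List.mem_map.mpr ⟨_, hmem, rfl⟩)

omit [CommSemiring k] in
/-- Depth entries are at most the index plus one. [cite: LST2021, §2] -/
theorem getD_gateWDepths_le_succ (G : List (Gate k σ)) :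
    ∀ i : ℕ, (gateWDepths prodWeight G).getD i 0 ≤ i + 1 := by
  intro i
  induction i using Nat.strong_induction_on with
  | _ i ih =>
    by_cases hi : i < G.length
    · rw [getD_gateWDepths prodWeight G hi, Gate.depthAgainst]
      have hpw : prodWeight G[i] ≤ 1 := by unfold prodWeight; split_ifs <;> simp
      have hmax : ((G[i].args.map (Operand.depthIn ((gateWDepths prodWeight G).take i))).foldr max 0) ≤ i := by
        refine foldr_max_le fun x hx => ?_
        obtain ⟨u, -, rfl⟩ := List.mem_map.mp hx
        cases u with
        | var _ => exact Nat.zero_le _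
        | const _ => exact Nat.zero_le _
        | gate j =>
            simp only [Operand.depthIn]
            by_cases hj : j < i
            · simp only [List.getD_eq_getElem?_getD, List.getElem?_take_of_lt hj]; exact (ih j hj).trans hj
            · rw [List.getD_eq_default _ _ (by rw [List.length_take]; omega)]; exact Nat.zero_le _
      omega
    · rw [List.getD_eq_default _ _ (by rw [gateWDepths_length]; omega)]; exact Nat.zero_le _

/-! ### Bands -/

/-- The band of gate `i` for band width `kk`: `(ds[i] - 1) / kk`, so band `b ≥ 1` holds the
depth entries in `(b·kk, (b+1)·kk]` and band `0` those in `[0, kk]`.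
[cite: LimayeSrinivasanTavenas2025, Lemma 20] -/
def bandOf (kk : ℕ) (ds : List ℕ) (i : ℕ) : ℕ := (ds.getD i 0 - 1) / kk

/-- Band arithmetic: an entry in band `b` is `≤ (b+1)·kk` and, if `b ≥ 1`, `≥ b·kk + 1`. -/
theorem bandOf_bounds {kk : ℕ} (hk : 0 < kk) (ds : List ℕ) (i : ℕ) :
    ds.getD i 0 ≤ (bandOf kk ds i + 1) * kk ∧ bandOf kk ds i * kk ≤ ds.getD i 0 - 1 := by
  unfold bandOf
  constructor
  · have := Nat.lt_succ_iff.mpr (le_refl ((ds.getD i 0 - 1) / kk))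
    have h2 : ds.getD i 0 - 1 < ((ds.getD i 0 - 1) / kk + 1) * kk := by
      rw [Nat.add_mul, Nat.one_mul]
      have := Nat.div_mul_le_self (ds.getD i 0 - 1) kk
      have := Nat.mod_lt (ds.getD i 0 - 1) hk
      have := Nat.div_add_mod (ds.getD i 0 - 1) kk
      rw [Nat.mul_comm] at this
      omega
    omega
  · exact Nat.div_mul_le_self _ _

/-- Bands are monotone in the depth entry. -/
theorem bandOf_mono (kk : ℕ) (ds : List ℕ) {i i' : ℕ} (h : ds.getD i' 0 ≤ ds.getD i 0) :
    bandOf kk ds i' ≤ bandOf kk ds i := by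
  unfold bandOf
  exact Nat.div_le_div_right (by omega)

/-! ### The band block -/

section Block

variable (kk b n d : ℕ) (ds : List ℕ) (vals : List (MvPolynomial σ k))

/-- Lift of an operand of gate `i` into the band-`b` block: variables are kept (left summand),
references to lower-band gates `i' < i` are redirected to the component-sum gate `s_{i'}` (index
`i'`), references to same-band gates `i'` to their copy at index `n + i'`, and junk references
(`i' ≥ i`) become the constant `0` (their value in the original circuit).
[cite: LimayeSrinivasanTavenas2025, Lemma 20] -/
def liftOp (i : ℕ) : Operand k σ → Operand k (σ ⊕ (Fin n × Fin d))
  | .var x => .var (Sum.inl x)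
  | .const c => .const c
  | .gate i' => if i' < i then (if bandOf kk ds i' < b then .gate i' else .gate (n + i')) else .const 0

/-- Lift of gate `i`: kept (operands lifted) if it lies in band `b`, blanked otherwise.
[cite: LimayeSrinivasanTavenas2025, Lemma 20] -/
def liftGate (i : ℕ) : Gate k σ → Gate k (σ ⊕ (Fin n × Fin d))
  | .sum args => if bandOf kk ds i = b then .sum (args.map fun a => (a.1, liftOp kk b n d ds i a.2))
      else .sum []
  | .prod us => if bandOf kk ds i = b then .prod (us.map (liftOp kk b n d ds i)) else .sum []

/-- The component-sum gate of gate `i`: `coeff₀(val_i) · 1 + Σ_{e<d} y_{i,e}` (the placeholder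
`y_{i,e}` stands for the degree-`(e+1)` component of `val_i`). [cite: LimayeSrinivasanTavenas2025, Lemma 20] -/
noncomputable def sGate (i : Fin n) : Gate k (σ ⊕ (Fin n × Fin d)) :=
  .sum ((coeff 0 (vals.getD i 0), .const 1) ::
    (List.finRange d).map fun e => ((1 : k), .var (Sum.inr (i, e))))

/-- The `n` component-sum gates. -/
noncomputable def sGates : List (Gate k (σ ⊕ (Fin n × Fin d))) := (List.finRange n).map (sGate n d vals)

/-- The band-`b` block of a prefix `G'` of the circuit: the component-sum gates followed by the
lifted gates of `G'`. [cite: LimayeSrinivasanTavenas2025, Lemma 20] -/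
noncomputable def bandBlock (G' : List (Gate k σ)) : List (Gate k (σ ⊕ (Fin n × Fin d))) :=
  sGates n d vals ++ G'.mapIdx (liftGate kk b n d ds)

/-- Length of the component-sum part. -/
@[simp] theorem length_sGates : (sGates n d vals : List (Gate k (σ ⊕ (Fin n × Fin d)))).length = n := by
  simp [sGates]

/-- Length of the band block. -/
@[simp] theorem length_bandBlock (G' : List (Gate k σ)) :
    (bandBlock kk b n d ds vals G').length = n + G'.length := by
  simp [bandBlock, List.length_mapIdx]

/-- The band block of an extended prefix. -/
theorem bandBlock_append_singleton (G' : List (Gate k σ)) (g : Gate k σ) :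
    bandBlock kk b n d ds vals (G' ++ [g]) =
      bandBlock kk b n d ds vals G' ++ [liftGate kk b n d ds G'.length g] := by
  simp [bandBlock, List.mapIdx_append, List.mapIdx_cons, List.append_assoc]

/-- The component-sum gates have depth `0`. -/
theorem gateWDepths_sGates :
    gateWDepths prodWeight (sGates n d vals : List (Gate k (σ ⊕ (Fin n × Fin d)))) =
      List.replicate n 0 := by
  have key : ∀ (A : List (Gate k (σ ⊕ (Fin n × Fin d)))),
      (∀ g ∈ A, prodWeight g = 0 ∧ ∀ u ∈ g.args, ∀ D : List ℕ, Operand.depthIn D u = 0) →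
      gateWDepths prodWeight A = List.replicate A.length 0 := by
    intro A hA
    induction A using List.reverseRecOn with
    | nil => simp [gateWDepths]
    | append_singleton A g ih =>
        rw [gateWDepths_append_singleton, ih fun g' hg' => hA g' (by simp [hg']),
          List.length_append, List.length_singleton, List.replicate_succ']
        congr 1
        obtain ⟨hpw, hargs⟩ := hA g (by simp)
        rw [hpw, Nat.zero_add]
        simp only [List.cons.injEq, and_true]
        refine foldr_max_eq_zero' fun x hx => ?_
        obtain ⟨u, hu, rfl⟩ := List.mem_map.mp hx
        exact hargs u hu _
  rw [key, length_sGates]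
  intro g hg
  simp only [sGates, List.mem_map] at hg
  obtain ⟨i, -, rfl⟩ := hg
  refine ⟨rfl, fun u hu D => ?_⟩
  simp only [sGate, Gate.args, List.map_cons, List.map_map, List.mem_cons, List.mem_map,
    Function.comp_apply] at hu
  rcases hu with rfl | ⟨e, -, rfl⟩ <;> rfl
where
  /-- `foldr max 0` of a list of zeros. -/
  foldr_max_eq_zero' {l : List ℕ} (h : ∀ x ∈ l, x = 0) : l.foldr max 0 = 0 := by
    induction l with
    | nil => rfl
    | cons a l ih => rw [List.foldr_cons, h a (by simp), ih (fun x hx => h x (by simp [hx]))]; rfl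

end Block

/-! ### Relative depth of the band block -/

section Depth

variable (kk b d : ℕ) (vals : List (MvPolynomial σ k))

/-- Lifted operands: depth against the block's depth list, termwise bounded by the original
operand depth minus the band offset `b·kk` (given the invariant on the block's entries).
[cite: LimayeSrinivasanTavenas2025, Lemma 20] -/
theorem depthIn_liftOp_le (n : ℕ) (ds DΦ : List ℕ) {i : ℕ} (hin : i ≤ n)
    (hs : ∀ idx < n, DΦ.getD idx 0 = 0)
    (hl : ∀ i' < i, DΦ.getD (n + i') 0 ≤ ds.getD i' 0 - b * kk) :
    ∀ u : Operand k σ, Operand.depthIn DΦ (liftOp kk b n d ds i u) ≤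
      Operand.depthIn (ds.take i) u - b * kk
  | .var x => by simp [liftOp, Operand.depthIn]
  | .const c => by simp [liftOp, Operand.depthIn]
  | .gate i' => by
      simp only [liftOp]
      by_cases hi' : i' < i
      · rw [if_pos hi']
        have horig : Operand.depthIn (ds.take i) (Operand.gate i' : Operand k σ) = ds.getD i' 0 := by
          simp only [Operand.depthIn, List.getD_eq_getElem?_getD, List.getElem?_take_of_lt hi']
        rw [horig]
        by_cases hb : bandOf kk ds i' < b
        · rw [if_pos hb, Operand.depthIn, hs i' (by omega)]; exact Nat.zero_le _
        · rw [if_neg hb, Operand.depthIn]; exact hl i' hi'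
      · rw [if_neg hi']
        simp [Operand.depthIn]

/-- `foldr max 0` commutes with truncated subtraction of a constant (upper bound form). -/
theorem foldr_max_sub_le {α : Type*} (l : List α) (f g : α → ℕ) (c : ℕ)
    (h : ∀ x ∈ l, f x ≤ g x - c) : (l.map f).foldr max 0 ≤ (l.map g).foldr max 0 - c := by
  refine foldr_max_le fun y hy => ?_
  obtain ⟨x, hx, rfl⟩ := List.mem_map.mp hy
  exact (h x hx).trans (Nat.sub_le_sub_right (le_foldr_max_of_mem (List.mem_map.mpr ⟨x, hx, rfl⟩)) c)

/-- Depth entry of a lifted gate: `0` if blanked, else at most `ds[i] - b·kk`.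
[cite: LimayeSrinivasanTavenas2025, Lemma 20] -/
theorem depthAgainst_liftGate_le {kk : ℕ} (hk : 0 < kk) (b d : ℕ) (G : List (Gate k σ))
    (DΦ : List ℕ) {i : ℕ} (hi : i < G.length)
    (hs : ∀ idx < G.length, DΦ.getD idx 0 = 0)
    (hl : ∀ i' < i, DΦ.getD (G.length + i') 0 ≤ (gateWDepths prodWeight G).getD i' 0 - b * kk) :
    Gate.depthAgainst prodWeight DΦ (liftGate kk b G.length d (gateWDepths prodWeight G) i G[i]) ≤
      if bandOf kk (gateWDepths prodWeight G) i = b then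
        (gateWDepths prodWeight G).getD i 0 - b * kk else 0 := by
  set ds := gateWDepths prodWeight G with hds
  by_cases hb : bandOf kk ds i = b
  · rw [if_pos hb]
    have hchar := getD_gateWDepths prodWeight G hi
    rw [← hds] at hchar
    have hband := (bandOf_bounds hk ds i).2
    rw [hb] at hband
    have hpw : prodWeight G[i] ≤ 1 := by unfold prodWeight; split_ifs <;> simp
    have hterm := depthIn_liftOp_le (k := k) (σ := σ) kk b d G.length ds DΦ hi.le hs hl
    -- the lifted gate has the same weight and lifted operands
    have key : ∀ g : Gate k σ, bandOf kk ds i = b →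
        Gate.depthAgainst prodWeight DΦ (liftGate kk b G.length d ds i g) ≤
          prodWeight g + ((g.args.map (Operand.depthIn (ds.take i))).foldr max 0 - b * kk) := by
      intro g hb'
      cases g with
      | sum args =>
          simp only [liftGate, hb', if_true, Gate.depthAgainst, prodWeight, Gate.isProd, Gate.args,
            List.map_map, Function.comp_def, Bool.false_eq_true, if_false, Nat.zero_add]
          have := foldr_max_sub_le args (fun a => Operand.depthIn DΦ (liftOp kk b G.length d ds i a.2))
            (fun a => Operand.depthIn (ds.take i) a.2) (b * kk) (fun a _ => hterm a.2)
          simpa [List.map_map, Function.comp_def] using this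
      | prod us =>
          simp only [liftGate, hb', if_true, Gate.depthAgainst, prodWeight, Gate.isProd, Gate.args,
            List.map_map, Function.comp_def, if_true]
          exact Nat.add_le_add_left (foldr_max_sub_le us _ _ (b * kk) (fun u _ => hterm u)) 1
    refine (key G[i] hb).trans ?_
    rw [hchar, Gate.depthAgainst]
    rw [Gate.depthAgainst] at hchar
    by_cases hb0 : b = 0
    · subst hb0; simp
    · have : 1 ≤ b * kk := Nat.one_le_iff_ne_zero.mpr (Nat.mul_ne_zero hb0 (by omega))
      omega
  · rw [if_neg hb]
    cases hg : G[i] with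
    | sum args => simp [liftGate, hb, Gate.depthAgainst, prodWeight, Gate.isProd, Gate.args]
    | prod us => simp [liftGate, hb, Gate.depthAgainst, prodWeight, Gate.isProd, Gate.args]

/-- The band block of the empty prefix is the list of component-sum gates. -/
theorem bandBlock_nil (n : ℕ) (ds : List ℕ) :
    bandBlock kk b n d ds vals ([] : List (Gate k σ)) = sGates n d vals := by
  simp [bandBlock]

/-- **Depth invariant of the band block** along prefixes of `G`: the component-sum entries are
`0`, the entry of a lifted gate `i'` is at most `ds[i'] - b·kk` (and `0` if blanked).
[cite: LimayeSrinivasanTavenas2025, Lemma 20] -/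
theorem gateWDepths_bandBlock_inv {kk : ℕ} (hk : 0 < kk) (G : List (Gate k σ)) :
    ∀ i : ℕ, i ≤ G.length →
      (∀ idx < G.length, (gateWDepths prodWeight
          (bandBlock kk b G.length d (gateWDepths prodWeight G) vals (G.take i))).getD idx 0 = 0) ∧
      (∀ i' < i, (gateWDepths prodWeight
          (bandBlock kk b G.length d (gateWDepths prodWeight G) vals (G.take i))).getD
            (G.length + i') 0 ≤
          if bandOf kk (gateWDepths prodWeight G) i' = b then
            (gateWDepths prodWeight G).getD i' 0 - b * kk else 0) := by
  intro i
  induction i with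
  | zero =>
      intro _
      rw [List.take_zero, bandBlock_nil, gateWDepths_sGates]
      exact ⟨fun idx hidx => by rw [List.getD_eq_getElem _ _ (by simpa), List.getElem_replicate],
        fun i' hi' => absurd hi' (Nat.not_lt_zero _)⟩
  | succ i ih =>
      intro hi
      have hi' : i < G.length := hi
      obtain ⟨hs, hl⟩ := ih hi'.le
      set Φ := bandBlock kk b G.length d (gateWDepths prodWeight G) vals (G.take i) with hΦ
      have hlenΦ : (gateWDepths prodWeight Φ).length = G.length + i := by
        rw [gateWDepths_length, hΦ, length_bandBlock, List.length_take, min_eq_left hi'.le]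
      have hstep : bandBlock kk b G.length d (gateWDepths prodWeight G) vals (G.take (i + 1)) =
          Φ ++ [liftGate kk b G.length d (gateWDepths prodWeight G) i G[i]] := by
        rw [List.take_succ_eq_append_getElem hi', bandBlock_append_singleton, List.length_take,
          min_eq_left hi'.le]
      rw [hstep, gateWDepths_append_singleton]
      have hl' : ∀ i' < i, (gateWDepths prodWeight Φ).getD (G.length + i') 0 ≤
          (gateWDepths prodWeight G).getD i' 0 - b * kk := fun i' hi'' =>
        (hl i' hi'').trans (by split_ifs <;> omega)
      refine ⟨fun idx hidx => ?_, fun i' hi'' => ?_⟩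
      · rw [List.getD_append _ _ _ _ (by omega)]; exact hs idx hidx
      · rcases Nat.lt_succ_iff_lt_or_eq.mp hi'' with hlt | rfl
        · rw [List.getD_append _ _ _ _ (by omega)]; exact hl i' hlt
        · rw [getD_append_at_length _ _ _ hlenΦ.symm]
          exact depthAgainst_liftGate_le hk b d G _ hi' hs hl'

/-- **Relative depth of the band block**: every depth entry of the band-`b` block of `G` is at
most the band width `kk`. [cite: LimayeSrinivasanTavenas2025, Lemma 20] -/
theorem gateWDepths_bandBlock_le {kk : ℕ} (hk : 0 < kk) (G : List (Gate k σ)) :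
    ∀ x ∈ gateWDepths prodWeight (bandBlock kk b G.length d (gateWDepths prodWeight G) vals G),
      x ≤ kk := by
  obtain ⟨hs, hl⟩ := gateWDepths_bandBlock_inv b d vals hk G G.length le_rfl
  rw [List.take_length] at hs hl
  intro x hx
  obtain ⟨idx, hidx, rfl⟩ := List.mem_iff_getElem.mp hx
  rw [← List.getD_eq_getElem _ 0 hidx]
  have hlen : (gateWDepths prodWeight
      (bandBlock kk b G.length d (gateWDepths prodWeight G) vals G)).length = G.length + G.length := by
    rw [gateWDepths_length, length_bandBlock]
  by_cases h : idx < G.length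
  · rw [hs idx h]; exact Nat.zero_le _
  · obtain ⟨i', rfl⟩ : ∃ i', idx = G.length + i' := ⟨idx - G.length, by omega⟩
    refine (hl i' (by omega)).trans ?_
    split_ifs with hb
    · have := (bandOf_bounds hk (gateWDepths prodWeight G) i').1
      rw [hb] at this
      rw [Nat.add_mul, Nat.one_mul] at this
      omega
    · exact Nat.zero_le _

end Depth

end Summit.ValiantsHypothesis.ValiantsHypothesis.Theorems.DepthWindow
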